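import Mathlib
import Summits.CriticalPhenomena.CardyFormulaZ2.Theorems.CardyMagicRigidityDefs
import Summits.CriticalPhenomena.CardyFormulaZ2.Theorems.CardyMagicRigidityPositiveConeDefs
import Literature.Probability.Percolation.FullPlaneCNL
import Literature.Probability.RandomPlanarGeometry.LocFinLoopConfig
import HarnessLib

/-!
# Stub `stub_precompactness`: reduction to pure `d_CN`-precompactness (T1) and regular modification (T2)

Crux `Summit.CriticalPhenomena.CardyFormulaZ2.Theses.CardyMagicRigidity.NestingRigidity`
(stmt-CriticalPhenomena-4835), line `positive-cone-weight-doubling`, registered stub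
`stub_precompactness : PrecompactRegular zEns ∧ PrecompactRegular tEns`
(`Theorems/CardyMagicRigidityPositiveConeDefs.lean`): every mesh sequence `δₖ → 0⁺` has a subsequence
along which the typed full-plane loop ensemble converges in DKKMO's coupling distance `d_CN`
(`LoopConfig.cnLawEDist`) to a law presented on `([0,1], Leb)` and carried by `Regular` configurations.

This helper file records, sorry-free, the FORMAL SPLITTING of the statement (for an arbitrary ensemble
`E : LoopEnsemble`) into

* (T1) pure `d_CN`-precompactness of the laws — every mesh sequence has a subsequence along which the laws
  of `E.X δₖ` converge in `cnLawEDist` to SOME law presented on the unit interval; and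
* (T2) regular modification — every sequential `d_CN`-limit presentation `X : [0,1] → C` of the ensemble can be
  replaced by an a.e.-`Regular` presentation `X'` with `d_CN(X s, X' s) = 0` for a.e. `s` (T2), or, in law form,
  with `cnLawEDist (E.X δₖ) X' → 0` along the same sequence (T2'),

both written INLINE as hypotheses (no new `def … : Prop`):

* `Precompact.cnLawEDist_le_of_ae_cnEDist_eq_zero` — LEMMA L: an a.e.-pointwise `d_CN`-null modification of the
  second presentation does not increase the coupling distance of probability laws (below scale `1` the same
  coupling works by the restricted triangle inequality `LoopConfig.IsClose.trans`, the null set being absorbed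
  by the second marginal; above scale `1` every coupling distance of probability laws is `≤ 1`,
  `LoopConfig.cnLawEDist_le_one`);
* `Precompact.tendsto_cnLawEDist_of_ae_cnEDist_eq_zero` — hence T2 ⇒ T2' along any sequence (squeeze);
* `precompactRegular_of_limits` (registered anchor) — GLUE: T1 ∧ T2' ⇒ `PrecompactRegular E` (pure logic), and
  `precompactRegular_of_modification` — T1 ∧ T2 ⇒ `PrecompactRegular E` for probability ensembles;
  `precompactLaw_of_precompactRegular` — conversely `PrecompactRegular E` contains T1;
* the site-`𝕋` side: `precompactLaw_tEns_of_exists_isFullPlaneCNLLaw` — T1 for `tEns` is IMMEDIATE from the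
  tree's named Camia–Newman fact `exists_isFullPlaneCNLLaw` (`Literature.Probability.Percolation.FullPlaneCNL`:
  the typed site loop ensembles converge in `d_CN` to a law on `[0,1]`; `tEns.P = triSitePercolation half`,
  `tEns.X = siteLoopConfig` by `rfl`), with `φ = id`; and `precompactRegular_tEns_of_exists_isFullPlaneCNLLaw`
  — `PrecompactRegular tEns` from that fact and the regular-modification statement T2 for `tEns`.

What is NOT here (see the stub map `work/stubs/Precompactness-map.md` of seat c4-0): T1 for bond-`ℤ²`
(Aizenman–Burchard: the (H1) discharge for the bond LOOP family — only the chordal interface is in the tree,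
`isTightLaws_map_bondInterface_holds` — and the soft machine "tight windowed laws in the AB space
`LoopSpace ℂ` ⇒ sequential `d_CN`-subsequential limit on `[0,1]`"), and T2 for either lattice (the fields
`Regular.boundary`, `Regular.separating`, `Regular.locallyFinite` of the LIMIT need percolation estimates;
`degreeOne`/`laminar` pass to `d_CN`-limits softly, companion file `…PrecompactnessRegularLimit`).
-/

noncomputable section

open MeasureTheory Set Filter Metric
open scoped Real Topology BigOperators ENNReal unitInterval

namespace Summit.CriticalPhenomena.CardyFormulaZ2.Cruxes.NestingRigidity.PositiveConeWeightDoubling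

open Literature.Probability.RandomPlanarGeometry Literature.Probability.Percolation
  Literature.Probability.LatticeModels
open Summit.CriticalPhenomena.CardyFormulaZ2.Theses.CardyMagicRigidity
open Summit.CriticalPhenomena.CardyFormulaZ2.Cruxes.NestingRigidity.RingCloudTomography

namespace Precompact

/-! ### Lemma L: `d_CN`-null modifications of a presentation -/

section LemmaL

variable {E : Type*} [NormedAddCommGroup E]
variable {Ω Ω' : Type*} [MeasurableSpace Ω] [MeasurableSpace Ω']

/-- Pointwise step of Lemma L: if `d_CN(c, x) ≤ ε₁` (printed relation) and `d_CN(x, x') = 0`, then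
`d_CN(c, x') ≤ ε` for every `ε > ε₁ > 0` with `ε ≤ 1` (restricted triangle inequality
`LoopConfig.IsClose.trans` with the second tolerance `ε − ε₁`). -/
theorem isClose_of_isClose_of_cnEDist_eq_zero {ε₁ ε : ℝ} (hε₁ : 0 < ε₁) (hlt : ε₁ < ε) (hε : ε ≤ 1)
    {c x x' : LoopConfig E} (h : LoopConfig.IsClose ε₁ c x) (h0 : LoopConfig.cnEDist x x' = 0) :
    LoopConfig.IsClose ε c x' := by
  have hx : LoopConfig.IsClose (ε - ε₁) x x' := (LoopConfig.cnEDist_eq_zero_iff.1 h0) _ (by linarith)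
  have := h.trans hε₁ (by linarith) (by linarith) hx
  rwa [add_sub_cancel] at this

/-- **Lemma L.** An a.e.-pointwise `d_CN`-null modification of the second presentation does not increase
DKKMO's coupling distance between probability laws: if `d_CN(X s, X' s) = 0` for `ν`-a.e. `s`, then
`d_CN((μ, Y), (ν, X')) ≤ d_CN((μ, Y), (ν, X))`.  For `d_CN((μ,Y),(ν,X)) < ε₁ < ε ≤ 1` a coupling `P` with
`P[d_CN(Y, X) > ε₁] < ε₁` has `{d_CN(Y, X') > ε} ⊆ {d_CN(Y, X) > ε₁} ∪ Ω × N` with `N ⊇` the exceptional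
null set measurable, and `P(Ω × N) = ν(N) = 0`; for `ε > 1` the product coupling works
(`LoopConfig.cnLawEDist_le_one`). -/
theorem cnLawEDist_le_of_ae_cnEDist_eq_zero (μ : Measure Ω) [IsProbabilityMeasure μ]
    (Y : Ω → LoopConfig E) (ν : Measure Ω') [IsProbabilityMeasure ν] {X X' : Ω' → LoopConfig E}
    (h : ∀ᵐ s ∂ν, LoopConfig.cnEDist (X s) (X' s) = 0) :
    LoopConfig.cnLawEDist μ Y ν X' ≤ LoopConfig.cnLawEDist μ Y ν X := by
  set a := LoopConfig.cnLawEDist μ Y ν X with ha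
  have ha1 : a ≤ 1 := LoopConfig.cnLawEDist_le_one μ Y ν X
  have hat : a ≠ ⊤ := ne_top_of_le_ne_top ENNReal.one_ne_top ha1
  rw [← ENNReal.ofReal_toReal hat]
  refine (LoopConfig.cnLawEDist_le_iff_forall_lt ENNReal.toReal_nonneg).2 fun ε hε ↦ ?_
  by_cases hε1 : 1 < ε
  · -- trivial coupling above scale one
    refine ⟨μ.prod ν, ?_, ?_, prob_le_one.trans_lt (ENNReal.one_lt_ofReal.2 hε1)⟩
    · rw [Measure.map_fst_prod, measure_univ, one_smul]
    · rw [Measure.map_snd_prod, measure_univ, one_smul]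
  · push Not at hε1
    -- an intermediate scale `a < ε₁ < ε`
    obtain ⟨ε₁, hε₁a, hε₁ε⟩ := exists_between hε
    have hε₁0 : 0 < ε₁ := lt_of_le_of_lt ENNReal.toReal_nonneg hε₁a
    have h1 : a < ENNReal.ofReal ε₁ := by
      rw [← ENNReal.ofReal_toReal hat]
      exact (ENNReal.ofReal_lt_ofReal_iff hε₁0).2 hε₁a
    obtain ⟨P, hP₁, hP₂, hP⟩ := LoopConfig.exists_coupling_of_cnLawEDist_lt h1
    -- the exceptional null set of the modification, made measurable
    obtain ⟨N, hNsub, hNm, hN0⟩ := exists_measurable_superset_of_null (μ := ν) h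
    refine ⟨P, hP₁, hP₂, ?_⟩
    have hsub : {p : Ω × Ω' | ¬ LoopConfig.IsClose ε (Y p.1) (X' p.2)} ⊆
        {p : Ω × Ω' | ¬ LoopConfig.IsClose ε₁ (Y p.1) (X p.2)} ∪ Prod.snd ⁻¹' N := by
      intro p hp
      by_contra hcon
      simp only [mem_union, mem_setOf_eq, mem_preimage, not_or, not_not] at hcon
      have h0 : LoopConfig.cnEDist (X p.2) (X' p.2) = 0 := by
        by_contra h0
        exact hcon.2 (hNsub h0)
      exact hp (isClose_of_isClose_of_cnEDist_eq_zero hε₁0 hε₁ε hε1 hcon.1 h0)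
    have hPN : P (Prod.snd ⁻¹' N) = 0 := by
      rw [← Measure.map_apply measurable_snd hNm, hP₂, hN0]
    calc P {p : Ω × Ω' | ¬ LoopConfig.IsClose ε (Y p.1) (X' p.2)}
        ≤ P ({p : Ω × Ω' | ¬ LoopConfig.IsClose ε₁ (Y p.1) (X p.2)} ∪ Prod.snd ⁻¹' N) := measure_mono hsub
      _ ≤ P {p : Ω × Ω' | ¬ LoopConfig.IsClose ε₁ (Y p.1) (X p.2)} + P (Prod.snd ⁻¹' N) :=
          measure_union_le _ _
      _ < ENNReal.ofReal ε₁ + 0 := by rw [hPN, add_zero, add_zero]; exact hP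
      _ ≤ ENNReal.ofReal ε := by rw [add_zero]; exact ENNReal.ofReal_le_ofReal hε₁ε.le

/-- **T2 ⇒ T2' along a sequence**: if the laws of `Y k` converge in `d_CN` to the law of `X` and `X'` is an
a.e.-pointwise `d_CN`-null modification of `X`, they converge to the law of `X'` as well (squeeze through
Lemma L). -/
theorem tendsto_cnLawEDist_of_ae_cnEDist_eq_zero {ι : Type*} {l : Filter ι} (μ : Measure Ω)
    [IsProbabilityMeasure μ] (Y : ι → Ω → LoopConfig E) (ν : Measure Ω') [IsProbabilityMeasure ν]
    {X X' : Ω' → LoopConfig E} (h : ∀ᵐ s ∂ν, LoopConfig.cnEDist (X s) (X' s) = 0)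
    (hX : Tendsto (fun k ↦ LoopConfig.cnLawEDist μ (Y k) ν X) l (𝓝 0)) :
    Tendsto (fun k ↦ LoopConfig.cnLawEDist μ (Y k) ν X') l (𝓝 0) :=
  tendsto_of_tendsto_of_tendsto_of_le_of_le tendsto_const_nhds hX (fun _ ↦ bot_le) fun k ↦
    cnLawEDist_le_of_ae_cnEDist_eq_zero μ (Y k) ν h

end LemmaL

end Precompact

/-! ### The glue: T1 ∧ T2' ⇒ `PrecompactRegular`, and T1 ∧ T2 ⇒ `PrecompactRegular` -/

/-- **GLUE (registered anchor of this file on the crux item).**  For an arbitrary mesh-indexed ensemble `E`: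
pure `d_CN`-precompactness of the laws (T1: every mesh sequence `δₖ → 0⁺` has a subsequence along which the
laws of `E.X δₖ` converge in DKKMO's coupling distance to SOME law presented on `([0,1], Leb)`) and the
law-level regular-modification property (T2': every sequential `d_CN`-limit presentation of the ensemble can
be replaced by an a.e.-`Regular` presentation with the same limit property along the same sequence) imply
`PrecompactRegular E` — apply T2' along the subsequence produced by T1 (pure logic). -/
theorem precompactRegular_of_limits : ∀ E : LoopEnsemble,
    (∀ δs : ℕ → ℝ, Tendsto δs atTop (𝓝[>] (0 : ℝ)) →
      ∃ φ : ℕ → ℕ, StrictMono φ ∧ ∃ X : unitInterval → LoopConfig ℂ,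
        Tendsto (fun k : ℕ ↦ LoopConfig.cnLawEDist E.P (E.X (δs (φ k))) volume X) atTop (𝓝 0)) →
    (∀ (δs : ℕ → ℝ) (X : unitInterval → LoopConfig ℂ), Tendsto δs atTop (𝓝[>] (0 : ℝ)) →
      Tendsto (fun k : ℕ ↦ LoopConfig.cnLawEDist E.P (E.X (δs k)) volume X) atTop (𝓝 0) →
      ∃ X' : unitInterval → LoopConfig ℂ, (∀ᵐ s : unitInterval, Regular (X' s)) ∧
        Tendsto (fun k : ℕ ↦ LoopConfig.cnLawEDist E.P (E.X (δs k)) volume X') atTop (𝓝 0)) →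
    PrecompactRegular E := by
  intro E h₁ h₂ δs hδs
  obtain ⟨φ, hφ, X, hX⟩ := h₁ δs hδs
  obtain ⟨X', hreg, hX'⟩ := h₂ (δs ∘ φ) X (hδs.comp hφ.tendsto_atTop) hX
  exact ⟨φ, hφ, X', hreg, hX'⟩

/-- **T1 ∧ T2 ⇒ `PrecompactRegular`** for an ensemble on a probability space, with T2 in its pointwise form:
every sequential `d_CN`-limit presentation `X` admits an a.e.-`Regular` `X'` with `d_CN(X s, X' s) = 0` for
a.e. `s` (Lemma L turns it into T2'). -/
theorem precompactRegular_of_modification (E : LoopEnsemble) [IsProbabilityMeasure E.P]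
    (h₁ : ∀ δs : ℕ → ℝ, Tendsto δs atTop (𝓝[>] (0 : ℝ)) →
      ∃ φ : ℕ → ℕ, StrictMono φ ∧ ∃ X : unitInterval → LoopConfig ℂ,
        Tendsto (fun k : ℕ ↦ LoopConfig.cnLawEDist E.P (E.X (δs (φ k))) volume X) atTop (𝓝 0))
    (h₂ : ∀ (δs : ℕ → ℝ) (X : unitInterval → LoopConfig ℂ), Tendsto δs atTop (𝓝[>] (0 : ℝ)) →
      Tendsto (fun k : ℕ ↦ LoopConfig.cnLawEDist E.P (E.X (δs k)) volume X) atTop (𝓝 0) →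
      ∃ X' : unitInterval → LoopConfig ℂ, (∀ᵐ s : unitInterval, Regular (X' s)) ∧
        ∀ᵐ s : unitInterval, LoopConfig.cnEDist (X s) (X' s) = 0) :
    PrecompactRegular E := by
  refine precompactRegular_of_limits E h₁ fun δs X hδs hX ↦ ?_
  obtain ⟨X', hreg, h0⟩ := h₂ δs X hδs hX
  exact ⟨X', hreg, Precompact.tendsto_cnLawEDist_of_ae_cnEDist_eq_zero E.P (fun k ↦ E.X (δs k)) volume h0 hX⟩

/-- Conversely, `PrecompactRegular E` contains the pure precompactness statement T1 (forget regularity). -/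
theorem precompactLaw_of_precompactRegular (E : LoopEnsemble) (h : PrecompactRegular E) :
    ∀ δs : ℕ → ℝ, Tendsto δs atTop (𝓝[>] (0 : ℝ)) →
      ∃ φ : ℕ → ℕ, StrictMono φ ∧ ∃ X : unitInterval → LoopConfig ℂ,
        Tendsto (fun k : ℕ ↦ LoopConfig.cnLawEDist E.P (E.X (δs (φ k))) volume X) atTop (𝓝 0) := by
  intro δs hδs
  obtain ⟨φ, hφ, X, -, hX⟩ := h δs hδs
  exact ⟨φ, hφ, X, hX⟩

/-! ### The site-`𝕋` side: T1 from the Camia–Newman fact -/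

/-- **T1 for site-`𝕋` from Camia–Newman.**  Given the tree's named fact `exists_isFullPlaneCNLLaw` (F. Camia,
C. M. Newman, CMP 268 (2006), Thms 1 and 6, in `d_CN` form: the typed loop ensembles `siteLoopConfig δ` of
critical site percolation converge in DKKMO's coupling distance to a law presented on `[0,1]`), every mesh
sequence `δₖ → 0⁺` converges — no subsequence needed (`φ = id`) — to that law: `tEns.P = triSitePercolation half`
and `tEns.X = siteLoopConfig` definitionally. -/
theorem precompactLaw_tEns_of_exists_isFullPlaneCNLLaw (h : exists_isFullPlaneCNLLaw) :
    ∀ δs : ℕ → ℝ, Tendsto δs atTop (𝓝[>] (0 : ℝ)) →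
      ∃ φ : ℕ → ℕ, StrictMono φ ∧ ∃ X : unitInterval → LoopConfig ℂ,
        Tendsto (fun k : ℕ ↦ LoopConfig.cnLawEDist tEns.P (tEns.X (δs (φ k))) volume X) atTop (𝓝 0) := by
  intro δs hδs
  obtain ⟨X, hX⟩ := h
  exact ⟨id, strictMono_id, X, hX.comp hδs⟩

/-- A full-plane CNL presentation is a `d_CN`-limit of `tEns` along EVERY mesh sequence (the form consumed by
the regular-modification statement T2). -/
theorem tendsto_cnLawEDist_tEns_of_isFullPlaneCNLLaw {X : unitInterval → LoopConfig ℂ}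
    (hX : IsFullPlaneCNLLaw volume X) {δs : ℕ → ℝ} (hδs : Tendsto δs atTop (𝓝[>] (0 : ℝ))) :
    Tendsto (fun k : ℕ ↦ LoopConfig.cnLawEDist tEns.P (tEns.X (δs k)) volume X) atTop (𝓝 0) :=
  hX.comp hδs

/-- **`PrecompactRegular tEns` from Camia–Newman + regular modification.**  The site-`𝕋` half of
`stub_precompactness` follows from the named fact `exists_isFullPlaneCNLLaw` and the pointwise
regular-modification statement T2 for `tEns` (every sequential `d_CN`-limit presentation of the site
ensembles — i.e. every presentation of the full-plane CLE₆ law reached along a mesh sequence — has an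
a.e.-`Regular` `d_CN`-null modification: a.s. regularity of full-plane CLE₆ samples, Camia–Newman Thm 2 plus
arm estimates; NOT in the tree). -/
theorem precompactRegular_tEns_of_exists_isFullPlaneCNLLaw (h : exists_isFullPlaneCNLLaw)
    (h₂ : ∀ (δs : ℕ → ℝ) (X : unitInterval → LoopConfig ℂ), Tendsto δs atTop (𝓝[>] (0 : ℝ)) →
      Tendsto (fun k : ℕ ↦ LoopConfig.cnLawEDist tEns.P (tEns.X (δs k)) volume X) atTop (𝓝 0) →
      ∃ X' : unitInterval → LoopConfig ℂ, (∀ᵐ s : unitInterval, Regular (X' s)) ∧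
        ∀ᵐ s : unitInterval, LoopConfig.cnEDist (X s) (X' s) = 0) :
    PrecompactRegular tEns := by
  haveI : IsProbabilityMeasure tEns.P := inferInstanceAs (IsProbabilityMeasure (triSitePercolation half))
  exact precompactRegular_of_modification tEns (precompactLaw_tEns_of_exists_isFullPlaneCNLLaw h) h₂

/-- Variant: it suffices to modify ONE full-plane CNL presentation `X` (the fact's), since along every mesh
sequence `tEns` converges to that same `X`. -/
theorem precompactRegular_tEns_of_isFullPlaneCNLLaw {X X' : unitInterval → LoopConfig ℂ}
    (hX : IsFullPlaneCNLLaw volume X) (hreg : ∀ᵐ s : unitInterval, Regular (X' s))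
    (h0 : ∀ᵐ s : unitInterval, LoopConfig.cnEDist (X s) (X' s) = 0) : PrecompactRegular tEns := by
  haveI : IsProbabilityMeasure tEns.P := inferInstanceAs (IsProbabilityMeasure (triSitePercolation half))
  intro δs hδs
  exact ⟨id, strictMono_id, X', hreg, Precompact.tendsto_cnLawEDist_of_ae_cnEDist_eq_zero tEns.P
    (fun k ↦ tEns.X (δs k)) volume h0 (hX.comp hδs)⟩

/-! ### Both lattices: the stub from the four named inputs -/

/-- **`stub_precompactness` from its four inputs BY NAME**: T1 and T2 (pointwise form) for bond-`ℤ²`, the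
Camia–Newman fact and T2 for site-`𝕋`. -/
theorem precompactness_of_inputs
    (h₁ : ∀ δs : ℕ → ℝ, Tendsto δs atTop (𝓝[>] (0 : ℝ)) →
      ∃ φ : ℕ → ℕ, StrictMono φ ∧ ∃ X : unitInterval → LoopConfig ℂ,
        Tendsto (fun k : ℕ ↦ LoopConfig.cnLawEDist zEns.P (zEns.X (δs (φ k))) volume X) atTop (𝓝 0))
    (h₂ : ∀ (δs : ℕ → ℝ) (X : unitInterval → LoopConfig ℂ), Tendsto δs atTop (𝓝[>] (0 : ℝ)) →
      Tendsto (fun k : ℕ ↦ LoopConfig.cnLawEDist zEns.P (zEns.X (δs k)) volume X) atTop (𝓝 0) →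
      ∃ X' : unitInterval → LoopConfig ℂ, (∀ᵐ s : unitInterval, Regular (X' s)) ∧
        ∀ᵐ s : unitInterval, LoopConfig.cnEDist (X s) (X' s) = 0)
    (h₃ : exists_isFullPlaneCNLLaw)
    (h₄ : ∀ (δs : ℕ → ℝ) (X : unitInterval → LoopConfig ℂ), Tendsto δs atTop (𝓝[>] (0 : ℝ)) →
      Tendsto (fun k : ℕ ↦ LoopConfig.cnLawEDist tEns.P (tEns.X (δs k)) volume X) atTop (𝓝 0) →
      ∃ X' : unitInterval → LoopConfig ℂ, (∀ᵐ s : unitInterval, Regular (X' s)) ∧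
        ∀ᵐ s : unitInterval, LoopConfig.cnEDist (X s) (X' s) = 0) :
    Precompactness := by
  haveI : IsProbabilityMeasure zEns.P :=
    inferInstanceAs (IsProbabilityMeasure (bondPercolation (zdGraph 2) half))
  exact ⟨precompactRegular_of_modification zEns h₁ h₂, precompactRegular_tEns_of_exists_isFullPlaneCNLLaw h₃ h₄⟩

end Summit.CriticalPhenomena.CardyFormulaZ2.Cruxes.NestingRigidity.PositiveConeWeightDoubling

end
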